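import Mathlib
import Literature.Barriers.PneNP.CorrelationPolytopeXCLowerBoundGraph
import Literature.Barriers.PneNP.ExtendedFormulationMinkowskiFaces
import Literature.Barriers.PneNP.ExtendedFormulationLinearImage
import Literature.Analysis.Convex.LinearProgrammingDuality
import Literature.Combinatorics.Optimization.KMRLpLowerBoundsUnconditional
import Literature.Combinatorics.Optimization.LpRelaxationOfNonnegativeFactorization

/-!
# FifoMatching · NNDivisionHard — CLASS K / K_θ: the MAX-CUT LP RELAXATION classes (part 1/4: cut directions, Laplacian values, LP relaxations `IsMaxCutApprox`, laws `MaxCutLP(Approx)Hard`, classes `CutDominant` / `GapThin`)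

Theorems-grade port (bytes staged by val-idea-43 g5 for a port hand) of §3g `…Cruxes.NNDivisionHard.VirtualPassenger.MaxCutLP43` of the
registered LINE `Cruxes/NNDivisionHard/Lines/virtual_passenger.lean` rev 18 @21a5fb60d209 (pen val-idea-42 g2), lines 977–1784 — statements and
proofs VERBATIM (author of the block: val-idea-43 g2/g3, card `maxcut-relaxation`, kernel `MaxCutLPSketch.lean` rev 3.3; pen intakes rev 9 / 13 / 15);
edits: namespace `…Theorems.FifoMatching.MaxCutLP`, `T` a local abbrev δ-equal to `XcDivision.T`, 30 helper docstrings, split in four parts for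
the 400-line cap.  Purpose: free ≈ 46 KB of the line's 200 KB workfile budget (pen's BYTES NOTE 2026-08-28T23:26:44Z); after landing the line
replaces §3g by `import` + `open …MaxCutLP` (names unchanged below the namespace).
-/

set_option linter.dupNamespace false

namespace Summit.ValiantsHypothesis.ValiantsHypothesis.Theorems.FifoMatching.MaxCutLP

open Matrix Finset
open scoped Pointwise
open Literature.Barriers.PneNP (HasEFOfSize)
open Literature.Combinatorics.Optimization (corPolytopeGraph corVec)

/-- the route threshold `T c n = 2^((log₂ n + c)^c)` — δ-equal to the line's `XcDivision.T`, restated so that this Theorems-grade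
file imports no crux workfile. -/
abbrev T (c n : ℕ) : ℕ := 2 ^ ((Nat.log 2 n + c) ^ c)

variable {h : ℕ}

/-- the single-edge CUT direction `δ_{ij}(y) = y_ii + y_jj − y_ij − y_ji`. -/
def cutDirG (i j : Fin h) : Fin h × Fin h → ℝ :=
  fun p => (if p = (i, i) then 1 else 0) + (if p = (j, j) then 1 else 0)
    - (if p = (i, j) then 1 else 0) - (if p = (j, i) then 1 else 0)

/-- `δ_{ij} ⬝ y = y_ii + y_jj − y_ij − y_ji`. -/
theorem cutDirG_dotProduct (i j : Fin h) (y : Fin h × Fin h → ℝ) :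
    cutDirG i j ⬝ᵥ y = y (i, i) + y (j, j) - y (i, j) - y (j, i) := by
  simp only [cutDirG, dotProduct, add_mul, sub_mul, ite_mul, one_mul, zero_mul, Finset.sum_add_distrib,
    Finset.sum_sub_distrib, Finset.sum_ite_eq', Finset.mem_univ, if_true]

/-- `δ_{ij}(bbᵀ) = [b_i ≠ b_j] ∈ {0,1}` — in particular NONNEGATIVE on every vertex of `COR(K_h)`. -/
theorem cutDirG_dot_corVec (i j : Fin h) (hij : i ≠ j) (b : Fin h → Bool) :
    cutDirG i j ⬝ᵥ corVec (⊤ : SimpleGraph (Fin h)) b = if b i = b j then 0 else 1 := by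
  rw [cutDirG_dotProduct,
    Literature.Combinatorics.Optimization.corVec_apply_diag,
    Literature.Combinatorics.Optimization.corVec_apply_diag,
    Literature.Combinatorics.Optimization.corVec_apply_adj _ _ ((SimpleGraph.top_adj i j).2 hij),
    Literature.Combinatorics.Optimization.corVec_apply_adj _ _ ((SimpleGraph.top_adj j i).2 (Ne.symm hij))]
  cases b i <;> cases b j <;> simp

/-- the cut direction is nonnegative on every vertex of `COR(K_h)`. -/
theorem cutDirG_dot_corVec_nonneg (i j : Fin h) (hij : i ≠ j) (b : Fin h → Bool) :
    0 ≤ cutDirG i j ⬝ᵥ corVec (⊤ : SimpleGraph (Fin h)) b := by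
  rw [cutDirG_dot_corVec i j hij]; split_ifs <;> norm_num

/-- off-diagonal part of a weighting (diagonal "edges" carry no cut direction). -/
def wOff (w : Fin h × Fin h → ℝ) (i j : Fin h) : ℝ := if i = j then 0 else w (i, j)

/-- off-diagonal weights of a nonnegative weighting are nonnegative. -/
theorem wOff_nonneg {w : Fin h × Fin h → ℝ} (hw : ∀ p, 0 ≤ w p) (i j : Fin h) : 0 ≤ wOff w i j := by
  unfold wOff; split_ifs
  · exact le_rfl
  · exact hw _

/-- the value of the weighted-graph (Laplacian) functional `L_w = Σ_{i≠j} w_ij δ_ij` at `y`. -/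
def lapVal (w : Fin h × Fin h → ℝ) (y : Fin h × Fin h → ℝ) : ℝ :=
  ∑ i, ∑ j, wOff w i j * (cutDirG i j ⬝ᵥ y)

/-- additivity of the Laplacian value in the point. -/
theorem lapVal_add (w : Fin h × Fin h → ℝ) (y z : Fin h × Fin h → ℝ) :
    lapVal w (y + z) = lapVal w y + lapVal w z := by
  simp [lapVal, dotProduct_add, mul_add, Finset.sum_add_distrib]

/-- homogeneity of the Laplacian value in the point. -/
theorem lapVal_smul (w : Fin h × Fin h → ℝ) (c : ℝ) (y : Fin h × Fin h → ℝ) :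
    lapVal w (c • y) = c * lapVal w y := by
  simp [lapVal, dotProduct_smul, Finset.mul_sum, mul_left_comm]

/-- the Laplacian value of `−y`. -/
theorem lapVal_neg (w : Fin h × Fin h → ℝ) (y : Fin h × Fin h → ℝ) :
    lapVal w (-y) = - lapVal w y := by
  have := lapVal_smul w (-1) y
  simpa using this

/-- a linear functional bounded by `δ` on `S` is bounded by `δ` on `conv S`. -/
theorem lapVal_le_of_mem_convexHull (w : Fin h × Fin h → ℝ) (S : Set (Fin h × Fin h → ℝ)) (δ : ℝ)
    (hS : ∀ x ∈ S, lapVal w x ≤ δ) : ∀ x ∈ convexHull ℝ S, lapVal w x ≤ δ := by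
  have hconv : Convex ℝ {x : Fin h × Fin h → ℝ | lapVal w x ≤ δ} :=
    convex_halfSpace_le ⟨fun x y => lapVal_add w x y, fun c x => by rw [lapVal_smul, smul_eq_mul]⟩ δ
  exact fun x hx => (convexHull_min (fun x hx => (hS x hx : x ∈ {x | lapVal w x ≤ δ})) hconv) hx

/-- cut value of the weighting `w` at the cut `b`. -/
def cutVal (w : Fin h × Fin h → ℝ) (b : Fin h → Bool) : ℝ := lapVal w (corVec (⊤ : SimpleGraph (Fin h)) b)

/-- MAX-CUT value of the weighting `w` (a maximum over the finitely many cuts). -/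
noncomputable def maxCut (w : Fin h × Fin h → ℝ) : ℝ :=
  (Finset.univ : Finset (Fin h → Bool)).sup' ⟨fun _ => false, Finset.mem_univ _⟩ (cutVal w)

/-- every cut value is at most the max-cut value. -/
theorem cutVal_le_maxCut (w : Fin h × Fin h → ℝ) (b : Fin h → Bool) : cutVal w b ≤ maxCut w :=
  Finset.le_sup' (cutVal w) (Finset.mem_univ b)

/-- `L_w ≤ maxcut(w)` on the whole correlation polytope. -/
theorem lapVal_le_maxCut_of_mem_cor (w : Fin h × Fin h → ℝ) :
    ∀ x ∈ corPolytopeGraph (⊤ : SimpleGraph (Fin h)), lapVal w x ≤ maxCut w := by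
  refine lapVal_le_of_mem_convexHull w _ _ ?_
  rintro _ ⟨b, rfl⟩
  exact cutVal_le_maxCut w b

/-! ## §2 MAX-CUT LP relaxations and the named facts (CLRS 2013 / KMR 2017) -/

/-- `R ⊇ COR(K_h)` is a `(1+θ)`-approximate LP relaxation of MAX-CUT on `h` vertices: its LP value on every NONNEGATIVE … ⟨abr.⟩ -/
def IsMaxCutApprox (θ : ℝ) (R : Set (Fin h × Fin h → ℝ)) : Prop :=
  corPolytopeGraph (⊤ : SimpleGraph (Fin h)) ⊆ R ∧
    ∀ w : Fin h × Fin h → ℝ, (∀ p, 0 ≤ w p) → ∀ y ∈ R, lapVal w y ≤ (1 + θ) * maxCut w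

/-- **named fact `MaxCutLPHard` (EXACT max-cut LPs are super-quasi-polynomial)** — a consequence of Kothari–Meka–Raghav … ⟨abr.⟩ -/
def MaxCutLPHard : Prop :=
  ∀ c : ℕ, ∃ h₀ : ℕ, ∀ h ≥ h₀, ∀ (R : Set (Fin h × Fin h → ℝ)) (r : ℕ),
    IsMaxCutApprox 0 R → HasEFOfSize R r → T c h < r

/-- **named fact `MaxCutLPApproxHard`** — the same source at every ratio above `1/2`: for each `θ < 1`, `(1+θ)`-approxi … ⟨abr.⟩ -/
def MaxCutLPApproxHard : Prop :=
  ∀ θ : ℝ, θ < 1 → ∀ c : ℕ, ∃ h₀ : ℕ, ∀ h ≥ h₀, ∀ (R : Set (Fin h × Fin h → ℝ)) (r : ℕ),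
    IsMaxCutApprox θ R → HasEFOfSize R r → T c h < r

/-- the exact max-cut LP law follows from the approximate one. -/
theorem maxCutLPHard_of_approx (hA : MaxCutLPApproxHard) : MaxCutLPHard :=
  hA 0 (by norm_num)

/-! ## §3 The passenger classes: CUT-DOMINANT (`K`) and GAP-THIN (`K_θ`) -/

/-- **CLASS K — CUT-DOMINANT passenger families**: one generator maximises every single-edge cut direction over the fam … ⟨abr.⟩ -/
def CutDominant (h : ℕ) {J : Type} (q : J → (Fin h × Fin h → ℝ)) : Prop :=
  ∃ j₀, ∀ i j : Fin h, i ≠ j → ∀ j' : J, cutDirG i j ⬝ᵥ q j' ≤ cutDirG i j ⬝ᵥ q j₀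

/-- **CLASS K_θ — GAP-THIN passenger families** (value level): one generator is, for every nonnegative instance `w`, wi … ⟨abr.⟩ -/
def GapThin (θ : ℝ) (h : ℕ) {J : Type} (q : J → (Fin h × Fin h → ℝ)) : Prop :=
  ∃ j₀, ∀ w : Fin h × Fin h → ℝ, (∀ p, 0 ≤ w p) → ∀ j' : J, lapVal w (q j') ≤ lapVal w (q j₀) + θ * maxCut w

/-- a CUT-DOMINANT family is GAP-THIN at tolerance `0`. -/
theorem gapThin_zero_of_cutDominant {J : Type} {q : J → (Fin h × Fin h → ℝ)} (hK : CutDominant h q) :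
    GapThin 0 h q := by
  obtain ⟨j₀, hj₀⟩ := hK
  refine ⟨j₀, fun w hw j' => ?_⟩
  rw [zero_mul, add_zero]
  unfold lapVal
  refine Finset.sum_le_sum fun i _ => Finset.sum_le_sum fun j _ => ?_
  by_cases hij : i = j
  · simp [wOff, hij]
  · exact mul_le_mul_of_nonneg_left (hj₀ i j hij j') (wOff_nonneg hw i j)

/-- ★ the translation lemma: a gap-thin family, translated so that its near-maximiser sits at the origin, turns … ⟨abr.⟩ -/
theorem isMaxCutApprox_translate {θ : ℝ} {K : ℕ} {q : Fin (K + 1) → (Fin h × Fin h → ℝ)} {j₀ : Fin (K + 1)}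
    (hj₀ : ∀ w : Fin h × Fin h → ℝ, (∀ p, 0 ≤ w p) → ∀ j', lapVal w (q j') ≤ lapVal w (q j₀) + θ * maxCut w) :
    IsMaxCutApprox θ ((fun x => x + -(q j₀)) ''
      (corPolytopeGraph (⊤ : SimpleGraph (Fin h)) + convexHull ℝ (Set.range q))) := by
  constructor
  · intro x hx
    refine ⟨x + q j₀, ?_, by simp⟩
    exact Set.add_mem_add hx (subset_convexHull ℝ _ ⟨j₀, rfl⟩)
  · rintro w hw _ ⟨y, hy, rfl⟩
    obtain ⟨p, hp, z, hz, rfl⟩ := Set.mem_add.1 hy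
    have hpz : lapVal w (p + z + -(q j₀)) = lapVal w p + (lapVal w z - lapVal w (q j₀)) := by
      rw [lapVal_add, lapVal_add, lapVal_neg]; ring
    have h1 : lapVal w p ≤ maxCut w := lapVal_le_maxCut_of_mem_cor w p hp
    have h2 : lapVal w z ≤ lapVal w (q j₀) + θ * maxCut w := by
      refine lapVal_le_of_mem_convexHull w (Set.range q) _ ?_ z hz
      rintro _ ⟨j', rfl⟩
      exact hj₀ w hw j'
    rw [hpz]
    linarith

/-- ★★ **CLASS K_θ IS DECIDED modulo KMR**: gap-thin budgeted-or-not passengers do not make `COR(K_h) + Q`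
quasi-polynomially cheap. -/
theorem gapThin_decided (hM : MaxCutLPApproxHard) (θ : ℝ) (hθ : θ < 1) :
    ∀ c : ℕ, ∃ h₀ : ℕ, ∀ h ≥ h₀, ∀ (K : ℕ) (q : Fin (K + 1) → (Fin h × Fin h → ℝ)) (r : ℕ),
      GapThin θ h q →
      HasEFOfSize (corPolytopeGraph (⊤ : SimpleGraph (Fin h)) + convexHull ℝ (Set.range q)) r → T c h < r := by
  intro c
  obtain ⟨h₀, hh₀⟩ := hM θ hθ c
  refine ⟨h₀, fun h hh K q r hK hEF => ?_⟩
  obtain ⟨j₀, hj₀⟩ := hK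
  exact hh₀ h hh _ r (isMaxCutApprox_translate hj₀) (hEF.image_add_const (-(q j₀)))

/-- ★★ **CLASS K IS DECIDED modulo KMR (exact form)**: cut-dominant passengers — `Z_full`, every 0-1 rank-one tower, ev … ⟨abr.⟩ -/
theorem cutDominant_decided (hM : MaxCutLPHard) :
    ∀ c : ℕ, ∃ h₀ : ℕ, ∀ h ≥ h₀, ∀ (K : ℕ) (q : Fin (K + 1) → (Fin h × Fin h → ℝ)) (r : ℕ),
      CutDominant h q →
      HasEFOfSize (corPolytopeGraph (⊤ : SimpleGraph (Fin h)) + convexHull ℝ (Set.range q)) r → T c h < r := by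
  intro c
  obtain ⟨h₀, hh₀⟩ := hM c
  refine ⟨h₀, fun h hh K q r hK hEF => ?_⟩
  obtain ⟨j₀, hj₀⟩ := gapThin_zero_of_cutDominant hK
  exact hh₀ h hh _ r (isMaxCutApprox_translate hj₀) (hEF.image_add_const (-(q j₀)))

end Summit.ValiantsHypothesis.ValiantsHypothesis.Theorems.FifoMatching.MaxCutLP
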